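import Literature.MathematicalPhysics.QuantumManyBody.PeriodicBoseGasLocalization
import Mathlib.Algebra.Module.ZLattice.Basic
import Mathlib.MeasureTheory.Group.FundamentalDomain
import Mathlib.MeasureTheory.Measure.Lebesgue.EqHaar
import Mathlib.MeasureTheory.Integral.Prod
import HarnessLib

/-!
# Fournais 2020, Lemma 3.2: proof of the potential-energy sliding identity

Topic `Literature/MathematicalPhysics/QuantumManyBody`, sibling of `PeriodicBoseGasLocalization.lean`
(provefact `Literature.MathematicalPhysics.QuantumManyBody.BoseGas.Fournais2020_condensation`). We discharge the named fact
`Fournais2020_lemma32` (= [Fournais2020, Lemma 3.2 (3.10)–(3.11)]):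
`theorem Fournais2020_lemma32_holds : Fournais2020_lemma32`.

The printed proof is one sentence: "Lemma 3.2 follows by direct calculation of the
`u`-integral". The calculation, made explicit (all quantities in `ℝ≥0∞`):

1. **Tiling** (`tsum_lintegral_cell_sub_latticeVec`): `∑_{n∈ℤ³} ∫_{[0,L)³} f(u - Ln) du = ∫_{ℝ³} f`
   — `[0,L)³` is a fundamental domain of `Lℤ³` (Mathlib's `ZSpan.isAddFundamentalDomain`).
2. **The `u`-integral** (`lintegral_locFunPer_mul_locFunPer`): for all `x, y ∈ ℝ³`,
   `∫_Ω χ_u^per(x) χ_u^per(y) du = ℓ³ ∑_{m∈ℤ³} (χ*χ)((x - y + Lm)/ℓ)`, by tiling, translation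
   invariance, the scaling `u = ℓt` and evenness of `χ`.
3. **One box only** (`tsum_selfConv_eq_single`): `χ*χ` is supported in `(-1,1)³`, so for
   `2ℓ < L` at most one lattice translate contributes: if `|zᵢ + Lmᵢ| < ℓ` for all `i` then
   `∑_{m'} (χ*χ)((z + Lm')/ℓ) = (χ*χ)((z + Lm)/ℓ)`.
4. **Cancellation** (`div_mul_tsum_selfConv`): for `φ` supported in `|w| < R ≤ ℓ` (here `φ = v` or
   `φ = g = v(1-ω)`) and `(χ*χ) > 0` on `|y| ≤ R/ℓ`,
   `φ(z+Lm)/(χ*χ)((z+Lm)/ℓ) · ∑_{m'}(χ*χ)((z+Lm')/ℓ) = φ(z+Lm)`; summing over `m`,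
   `W^per(z) · ∑_{m'}(χ*χ)((z+Lm')/ℓ) = v^per(z)` and likewise for `W₁^per`, `g^per`.
5. Assembly: the pair part is 2 + 4 termwise in `∑_{i<j}`; the one-body part is 2 + 4 followed
   by Tonelli and tiling once more, `∫_Ω g^per(xᵢ - y) dy = ∫_{ℝ³} g`.

## References

* [Fournais2020] S. Fournais, *Length scales for BEC in the dilute Bose gas*, arXiv:2011.00309,
  EMS Ser. Congr. Rep. 18 (2021): Lemma 3.2, (3.4)–(3.11), (2.2)–(2.4), (2.8).
* [BrietzkeFournaisSolovej2020] B. Brietzke, S. Fournais, J. P. Solovej, Comm. Math. Phys. 376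
  (2020), arXiv:1901.00539: Lemma 5.2 (the box version of the same computation), (5.8)–(5.9).
-/

noncomputable section

open MeasureTheory Filter Metric WithLp Function
open scoped ENNReal NNReal

namespace Literature.MathematicalPhysics.QuantumManyBody.BoseGas

/-! ### The localisation function: support, compact support, measurability -/

variable {χ : Space → ℝ}

/-- A localisation function is continuous. [cite: Fournais2020, (2.2)] -/
theorem IsLocalizationFunction.continuous (hχ : IsLocalizationFunction χ) : Continuous χ :=
  hχ.contDiff.continuous

/-- A localisation function is measurable. [cite: Fournais2020, (2.2)] -/
theorem IsLocalizationFunction.measurable (hχ : IsLocalizationFunction χ) : Measurable χ :=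
  hχ.continuous.measurable

/-- `χ(x) = 0` as soon as one coordinate satisfies `|xₖ| ≥ ½`. [cite: Fournais2020, (2.2)] -/
theorem IsLocalizationFunction.eq_zero (hχ : IsLocalizationFunction χ) {x : Space} {k : Fin 3}
    (hk : 2⁻¹ ≤ |x k|) : χ x = 0 := by
  by_contra h
  have := hχ.tsupport_subset (subset_tsupport _ h) k
  linarith

/-- The self-convolution `χ*χ` vanishes as soon as one coordinate satisfies `|yₖ| ≥ 1`
(`supp χ ⊂ (-½,½)³`). [cite: Fournais2020, (2.2), (2.4)] -/
theorem selfConv_eq_zero (hχ : IsLocalizationFunction χ) {y : Space} {k : Fin 3}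
    (hk : 1 ≤ |y k|) : selfConv χ y = 0 := by
  rw [selfConv_apply]
  refine integral_eq_zero_of_ae (Eventually.of_forall fun z => ?_)
  show χ (y - z) * χ z = 0
  by_cases hz : 2⁻¹ ≤ |z k|
  · rw [hχ.eq_zero hz, mul_zero]
  · rw [hχ.eq_zero (k := k) ?_, zero_mul]
    rw [PiLp.sub_apply]
    have := abs_sub_abs_le_abs_sub (y k) (z k)
    push Not at hz
    linarith

/-- If `(χ*χ)(y) ≠ 0` then `|yₖ| < 1` for every coordinate. [cite: Fournais2020, (2.4)] -/
theorem abs_lt_one_of_selfConv_ne_zero (hχ : IsLocalizationFunction χ) {y : Space}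
    (h : selfConv χ y ≠ 0) (k : Fin 3) : |y k| < 1 := by
  by_contra hk
  exact h (selfConv_eq_zero hχ (not_lt.mp hk))

/-- The self-convolution `χ*χ` is measurable (it is continuous). [cite: Fournais2020, (2.4)] -/
theorem measurable_selfConv (hχ : IsLocalizationFunction χ) : Measurable (selfConv χ) :=
  hχ.continuous_selfConv.measurable

/-! ### Lattice vectors -/

/-- Coordinates of a lattice vector: `(Ln)_k = L n_k`. [folklore] -/
@[simp]
theorem latticeVec_apply (L : ℝ) (n : Fin 3 → ℤ) (k : Fin 3) : latticeVec L n k = L * n k := rfl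

/-- `n ↦ Ln` is additive. [folklore] -/
theorem latticeVec_add (L : ℝ) (m n : Fin 3 → ℤ) :
    latticeVec L (m + n) = latticeVec L m + latticeVec L n := by
  ext k; simp [mul_add]

/-- `L(-n) = -(Ln)`. [folklore] -/
theorem latticeVec_neg (L : ℝ) (n : Fin 3 → ℤ) : latticeVec L (-n) = -latticeVec L n := by
  ext k; simp

/-- `L(m - n) = Lm - Ln`. [folklore] -/
theorem latticeVec_sub (L : ℝ) (m n : Fin 3 → ℤ) :
    latticeVec L (m - n) = latticeVec L m - latticeVec L n := by
  ext k; simp [mul_sub]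

/-! ### Tiling `ℝ³` by the translates of the cell -/

/-- **Tiling.** `[0,L)³` is a fundamental domain of `Lℤ³`: for every `f ≥ 0`,
`∑_{n∈ℤ³} ∫_{[0,L)³} f(u - Ln) du = ∫_{ℝ³} f`. [folklore] -/
theorem tsum_lintegral_cell_sub_latticeVec {L : ℝ} (hL : 0 < L) (f : Space → ℝ≥0∞) :
    ∑' n : Fin 3 → ℤ, ∫⁻ u in cell L, f (u - latticeVec L n) = ∫⁻ u, f u := by
  let b₀ : Module.Basis (Fin 3) ℝ Space := (EuclideanSpace.basisFun (Fin 3) ℝ).toBasis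
  let b : Module.Basis (Fin 3) ℝ Space := b₀.unitsSMul fun _ => Units.mk0 L hL.ne'
  have hb : ∀ i, b i = L • EuclideanSpace.single i (1 : ℝ) := fun i => by
    simp [b, b₀, Module.Basis.unitsSMul_apply]
  have hrepr : ∀ (x : Space) (i : Fin 3), b.repr x i = L⁻¹ * x i := fun x i => by
    simp [b, b₀, Units.smul_def]
  have hfd : ZSpan.fundamentalDomain b = cell L := by
    ext x
    simp only [ZSpan.mem_fundamentalDomain, cell, Set.mem_setOf_eq, hrepr, Set.mem_Ico]
    refine forall_congr' fun i => ?_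
    rw [← div_eq_inv_mul, le_div_iff₀ hL, div_lt_iff₀ hL, zero_mul, one_mul]
  have hF := ZSpan.isAddFundamentalDomain' b (volume : Measure Space)
  haveI : Countable (Submodule.span ℤ (Set.range b)).toAddSubgroup := by
    change Countable (Submodule.span ℤ (Set.range b))
    infer_instance
  rw [hF.lintegral_eq_tsum' f, hfd]
  -- reindex the lattice by `ℤ³`
  let bZ := b.restrictScalars ℤ
  let e : (Fin 3 → ℤ) ≃ (Submodule.span ℤ (Set.range b)).toAddSubgroup :=
    bZ.equivFun.symm.toEquiv
  have he : ∀ n : Fin 3 → ℤ, ((e n : Submodule.span ℤ (Set.range b)) : Space) = latticeVec L n := by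
    intro n
    simp only [e, LinearEquiv.coe_toEquiv, Module.Basis.equivFun_symm_apply, Submodule.coe_sum,
      Submodule.coe_smul_of_tower, bZ, Module.Basis.restrictScalars_apply, hb]
    ext k
    rw [latticeVec_apply, WithLp.ofLp_sum, Finset.sum_apply,
      Finset.sum_eq_single k (fun i _ hi => by simp [hi]) (by simp)]
    simp [mul_comm]
  rw [← e.tsum_eq]
  refine tsum_congr fun n => lintegral_congr fun u => ?_
  rw [AddSubgroup.vadd_def, vadd_eq_add, AddSubgroup.coe_neg, neg_add_eq_sub]
  congr 2
  exact (he n).symm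

/-- **Scaling.** `∫ f(w/ℓ) dw = ℓ³ ∫ f` on `ℝ³`. [folklore] -/
theorem lintegral_comp_inv_smul {ℓ : ℝ} (hℓ : 0 < ℓ) {f : Space → ℝ≥0∞} (hf : Measurable f) :
    ∫⁻ w, f (ℓ⁻¹ • w) = ENNReal.ofReal (ℓ ^ 3) * ∫⁻ t, f t := by
  have hℓ' : ℓ⁻¹ ≠ 0 := inv_ne_zero hℓ.ne'
  rw [← lintegral_map hf (measurable_const_smul ℓ⁻¹), Measure.map_addHaar_smul volume hℓ',
    lintegral_smul_measure, finrank_euclideanSpace_fin, inv_pow, inv_inv,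
    abs_of_pos (pow_pos hℓ 3), smul_eq_mul]

/-! ### Measurability of the localised objects -/

/-- `(u, x) ↦ χ_u(x)` is continuous. [cite: Fournais2020, (3.6)] -/
theorem continuous_locFun₂ (hχ : IsLocalizationFunction χ) (ℓ : ℝ) :
    Continuous fun p : Space × Space => locFun χ ℓ p.1 p.2 := by
  unfold locFun
  have h := hχ.continuous
  fun_prop

/-- `u ↦ χ_u(x)` is measurable (as an `ℝ≥0∞`-valued function). [cite: Fournais2020, (3.6)] -/
theorem measurable_locFun (hχ : IsLocalizationFunction χ) (ℓ : ℝ) (x : Space) :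
    Measurable fun u : Space => ENNReal.ofReal (locFun χ ℓ u x) :=
  ((continuous_locFun₂ hχ ℓ).comp (continuous_id.prodMk continuous_const)).measurable.ennreal_ofReal

/-- `(u, x) ↦ χ_u^per(x)` is measurable. [cite: Fournais2020, (3.7)] -/
theorem measurable_locFunPer₂ (hχ : IsLocalizationFunction χ) (ℓ L : ℝ) :
    Measurable fun p : Space × Space => locFunPer χ ℓ L p.1 p.2 := by
  unfold locFunPer
  refine Measurable.tsum fun n => ?_
  exact ((continuous_locFun₂ hχ ℓ).comp (continuous_fst.prodMk (continuous_snd.add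
    continuous_const))).measurable.ennreal_ofReal

/-- `u ↦ χ_u^per(x)` is measurable. [cite: Fournais2020, (3.7)] -/
theorem measurable_locFunPer (hχ : IsLocalizationFunction χ) (ℓ L : ℝ) (x : Space) :
    Measurable fun u : Space => locFunPer χ ℓ L u x :=
  Measurable.comp (f := fun u : Space => (u, x)) (g := fun p : Space × Space => locFunPer χ ℓ L p.1 p.2)
    (measurable_locFunPer₂ hχ ℓ L) (measurable_id.prodMk measurable_const)

/-- `x ↦ χ_u^per(x)` is measurable. [cite: Fournais2020, (3.7)] -/
theorem measurable_locFunPer_right (hχ : IsLocalizationFunction χ) (ℓ L : ℝ) (u : Space) :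
    Measurable fun x : Space => locFunPer χ ℓ L u x :=
  Measurable.comp (f := fun x : Space => (u, x)) (g := fun p : Space × Space => locFunPer χ ℓ L p.1 p.2)
    (measurable_locFunPer₂ hχ ℓ L) (measurable_const.prodMk measurable_id)

/-- `W^per` is measurable. [cite: Fournais2020, (3.7)] -/
theorem measurable_bigWPer {v : ℝ → ℝ≥0∞} (hv : Measurable v) (hχ : IsLocalizationFunction χ)
    (ℓ L : ℝ) : Measurable (bigWPer v χ ℓ L) := by
  unfold bigWPer bigW
  have h := measurable_selfConv hχ
  refine Measurable.tsum fun n => ?_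
  exact (hv.comp (by fun_prop)).div ((h.comp (by fun_prop)).ennreal_ofReal)

/-- `W₁^per` is measurable. [cite: Fournais2020, (3.7)] -/
theorem measurable_bigW₁Per {v : ℝ → ℝ≥0∞} (hv : Measurable v) {ω : Space → ℝ} (hω : Measurable ω)
    (hχ : IsLocalizationFunction χ) (ℓ L : ℝ) : Measurable (bigW₁Per v ω χ ℓ L) := by
  unfold bigW₁Per bigW₁
  have h := measurable_selfConv hχ
  refine Measurable.tsum fun n => ?_
  exact ((hv.comp (by fun_prop)).mul ((measurable_const.sub (hω.comp (by fun_prop))).ennreal_ofReal)).div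
    ((h.comp (by fun_prop)).ennreal_ofReal)

/-! ### The lattice sum of `χ*χ` and the `u`-integral -/

/-- `∫ χ_w(x) χ_w(c) dw = ℓ³ (χ*χ)((x - c)/ℓ)` (translation invariance, the scaling `w = ℓt`,
evenness of `χ`). [cite: Fournais2020, proof of Lemma 3.2] -/
theorem lintegral_locFun_mul_locFun (hχ : IsLocalizationFunction χ) {ℓ : ℝ} (hℓ : 0 < ℓ)
    (x c : Space) :
    ∫⁻ w, ENNReal.ofReal (locFun χ ℓ w x) * ENNReal.ofReal (locFun χ ℓ w c) =
      ENNReal.ofReal (ℓ ^ 3) * ENNReal.ofReal (selfConv χ (ℓ⁻¹ • (x - c))) := by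
  have hm := hχ.measurable
  have hc := hχ.continuous
  calc ∫⁻ w, ENNReal.ofReal (locFun χ ℓ w x) * ENNReal.ofReal (locFun χ ℓ w c)
      = ∫⁻ w, ENNReal.ofReal (locFun χ ℓ (w + c) x) * ENNReal.ofReal (locFun χ ℓ (w + c) c) :=
        (lintegral_add_right_eq_self (μ := (volume : Measure Space))
          (fun w => ENNReal.ofReal (locFun χ ℓ w x) * ENNReal.ofReal (locFun χ ℓ w c)) c).symm
    _ = ∫⁻ w, (fun t : Space => ENNReal.ofReal (χ (ℓ⁻¹ • (x - c) - t)) * ENNReal.ofReal (χ t))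
          (ℓ⁻¹ • w) := by
        refine lintegral_congr fun w => ?_
        simp only [locFun]
        rw [show x - (w + c) = (x - c) - w by abel, smul_sub, show c - (w + c) = -w by abel,
          smul_neg, hχ.even]
    _ = ENNReal.ofReal (ℓ ^ 3) *
          ∫⁻ t, ENNReal.ofReal (χ (ℓ⁻¹ • (x - c) - t)) * ENNReal.ofReal (χ t) :=
        lintegral_comp_inv_smul hℓ
          (f := fun t : Space => ENNReal.ofReal (χ (ℓ⁻¹ • (x - c) - t)) * ENNReal.ofReal (χ t))
          (by fun_prop)
    _ = ENNReal.ofReal (ℓ ^ 3) * ENNReal.ofReal (selfConv χ (ℓ⁻¹ • (x - c))) := by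
        congr 1
        rw [selfConv_apply, ofReal_integral_eq_lintegral_ofReal]
        · exact lintegral_congr fun t => (ENNReal.ofReal_mul (hχ.nonneg _)).symm
        · have hcs : HasCompactSupport fun t : Space => χ (ℓ⁻¹ • (x - c) - t) * χ t :=
            hχ.hasCompactSupport.mul_left
          exact (by fun_prop : Continuous fun t : Space =>
            χ (ℓ⁻¹ • (x - c) - t) * χ t).integrable_of_hasCompactSupport hcs
        · exact Eventually.of_forall fun t => mul_nonneg (hχ.nonneg _) (hχ.nonneg _)

/-- **The `u`-integral.** For all `x, y ∈ ℝ³` (and `0 < ℓ`, `0 < L`),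
`∫_{[0,L)³} χ_u^per(x) χ_u^per(y) du = ℓ³ ∑_{m∈ℤ³} (χ*χ)((x - y + Lm)/ℓ)`.
[cite: Fournais2020, proof of Lemma 3.2] -/
theorem lintegral_locFunPer_mul_locFunPer (hχ : IsLocalizationFunction χ) {ℓ L : ℝ}
    (hℓ : 0 < ℓ) (hL : 0 < L) (x y : Space) :
    ∫⁻ u in cell L, locFunPer χ ℓ L u x * locFunPer χ ℓ L u y =
      ENNReal.ofReal (ℓ ^ 3) *
        ∑' m : Fin 3 → ℤ, ENNReal.ofReal (selfConv χ (ℓ⁻¹ • (x - y + latticeVec L m))) := by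
  have hm := measurable_locFun hχ ℓ
  calc ∫⁻ u in cell L, locFunPer χ ℓ L u x * locFunPer χ ℓ L u y
      = ∫⁻ u in cell L, ∑' n : Fin 3 → ℤ, ∑' m : Fin 3 → ℤ,
          ENNReal.ofReal (locFun χ ℓ u (x + latticeVec L n)) *
            ENNReal.ofReal (locFun χ ℓ u (y + latticeVec L m)) := by
        simp only [locFunPer, ENNReal.tsum_mul_right, ENNReal.tsum_mul_left]
    _ = ∑' n : Fin 3 → ℤ, ∑' m : Fin 3 → ℤ, ∫⁻ u in cell L,
          ENNReal.ofReal (locFun χ ℓ u (x + latticeVec L n)) *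
            ENNReal.ofReal (locFun χ ℓ u (y + latticeVec L m)) := by
        rw [lintegral_tsum fun n => ?_]
        · exact tsum_congr fun n => lintegral_tsum fun m => ((hm _).mul (hm _)).aemeasurable
        · exact (Measurable.tsum fun m => (hm _).mul (hm _)).aemeasurable
    _ = ∑' n : Fin 3 → ℤ, ∑' m : Fin 3 → ℤ, ∫⁻ u in cell L,
          ENNReal.ofReal (locFun χ ℓ (u - latticeVec L n) x) *
            ENNReal.ofReal (locFun χ ℓ (u - latticeVec L n) (y - latticeVec L m)) := by
        refine tsum_congr fun n => ?_
        rw [← (Equiv.subLeft n).tsum_eq]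
        refine tsum_congr fun m => lintegral_congr fun u => ?_
        simp only [Equiv.subLeft_apply, locFun, latticeVec_sub]
        rw [show x + latticeVec L n - u = x - (u - latticeVec L n) by abel,
          show y + (latticeVec L n - latticeVec L m) - u =
            y - latticeVec L m - (u - latticeVec L n) by abel]
    _ = ∑' m : Fin 3 → ℤ, ∫⁻ w,
          ENNReal.ofReal (locFun χ ℓ w x) * ENNReal.ofReal (locFun χ ℓ w (y - latticeVec L m)) := by
        rw [ENNReal.tsum_comm]
        exact tsum_congr fun m => tsum_lintegral_cell_sub_latticeVec hL fun w =>
          ENNReal.ofReal (locFun χ ℓ w x) * ENNReal.ofReal (locFun χ ℓ w (y - latticeVec L m))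
    _ = ∑' m : Fin 3 → ℤ, ENNReal.ofReal (ℓ ^ 3) *
          ENNReal.ofReal (selfConv χ (ℓ⁻¹ • (x - y + latticeVec L m))) := by
        refine tsum_congr fun m => ?_
        rw [lintegral_locFun_mul_locFun hχ hℓ, show x - (y - latticeVec L m) =
          x - y + latticeVec L m by abel]
    _ = ENNReal.ofReal (ℓ ^ 3) *
          ∑' m : Fin 3 → ℤ, ENNReal.ofReal (selfConv χ (ℓ⁻¹ • (x - y + latticeVec L m))) := by
        rw [ENNReal.tsum_mul_left]

/-! ### One box only, and the cancellation of `χ*χ` -/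

/-- **One box only.** If `|zᵢ + Lmᵢ| < ℓ` for all `i` (and `2ℓ < L`), then `m` is the only
lattice point contributing to `∑_{m'} (χ*χ)((z + Lm')/ℓ)`. [cite: Fournais2020, proof of Lemma 3.2] -/
theorem tsum_selfConv_eq_single (hχ : IsLocalizationFunction χ) {ℓ L : ℝ} (hℓ : 0 < ℓ)
    (hL : 2 * ℓ < L) {z : Space} {m : Fin 3 → ℤ} (hm : ∀ i, |z i + L * m i| < ℓ) :
    ∑' m' : Fin 3 → ℤ, ENNReal.ofReal (selfConv χ (ℓ⁻¹ • (z + latticeVec L m'))) =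
      ENNReal.ofReal (selfConv χ (ℓ⁻¹ • (z + latticeVec L m))) := by
  refine tsum_eq_single m fun m' hm' => ?_
  rw [ENNReal.ofReal_eq_zero]
  refine le_of_eq ?_
  by_contra h
  refine hm' (funext fun i => ?_)
  have h1 : |z i + L * m' i| < ℓ := by
    have := abs_lt_one_of_selfConv_ne_zero hχ h i
    rw [PiLp.smul_apply, PiLp.add_apply, latticeVec_apply, smul_eq_mul, abs_mul,
      abs_of_pos (inv_pos.mpr hℓ), ← div_eq_inv_mul, div_lt_one hℓ] at this
    exact this
  have h2 := hm i
  by_contra hne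
  have hint : (1 : ℝ) ≤ |(m' i : ℝ) - m i| := by
    rw [← Int.cast_sub, ← Int.cast_abs, ← Int.cast_one, Int.cast_le]
    exact Int.one_le_abs (sub_ne_zero.mpr hne)
  have h3 : |L * ((m' i : ℝ) - m i)| < 2 * ℓ := by
    calc |L * ((m' i : ℝ) - m i)| = |(z i + L * m' i) - (z i + L * m i)| := by ring_nf
      _ ≤ |z i + L * m' i| + |z i + L * m i| := abs_sub _ _
      _ < 2 * ℓ := by linarith
  rw [abs_mul, abs_of_pos (by linarith : (0 : ℝ) < L)] at h3
  nlinarith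

/-- **Cancellation.** Let `φ ≥ 0` be supported in the open ball of radius `R ≤ ℓ`, `2ℓ < L`, and
`(χ*χ)(y) > 0` for `|y| ≤ R/ℓ`. Then, for every `z` and lattice point `m`,
`φ(z+Lm)/(χ*χ)((z+Lm)/ℓ) · ∑_{m'} (χ*χ)((z+Lm')/ℓ) = φ(z+Lm)`. [cite: Fournais2020, proof of Lemma 3.2] -/
theorem div_mul_tsum_selfConv (hχ : IsLocalizationFunction χ) {ℓ L R : ℝ} (hℓ : 0 < ℓ)
    (hRℓ : R ≤ ℓ) (hL : 2 * ℓ < L) (hpos : ∀ y : Space, ‖y‖ ≤ R / ℓ → 0 < selfConv χ y)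
    {φ : Space → ℝ≥0∞} (hφ : ∀ w, φ w ≠ 0 → ‖w‖ < R) (z : Space) (m : Fin 3 → ℤ) :
    φ (z + latticeVec L m) / ENNReal.ofReal (selfConv χ (ℓ⁻¹ • (z + latticeVec L m))) *
        ∑' m' : Fin 3 → ℤ, ENNReal.ofReal (selfConv χ (ℓ⁻¹ • (z + latticeVec L m'))) =
      φ (z + latticeVec L m) := by
  by_cases h0 : φ (z + latticeVec L m) = 0
  · rw [h0, ENNReal.zero_div, zero_mul]
  have hR : ‖z + latticeVec L m‖ < R := hφ _ h0
  have hcoord : ∀ i, |z i + L * m i| < ℓ := fun i =>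
    calc |z i + L * m i| = ‖(z + latticeVec L m) i‖ := by simp [Real.norm_eq_abs]
      _ ≤ ‖z + latticeVec L m‖ := PiLp.norm_apply_le _ i
      _ < ℓ := hR.trans_le hRℓ
  rw [tsum_selfConv_eq_single hχ hℓ hL hcoord]
  have hp : 0 < selfConv χ (ℓ⁻¹ • (z + latticeVec L m)) := by
    refine hpos _ ?_
    rw [norm_smul, norm_inv, Real.norm_of_nonneg hℓ.le, div_eq_inv_mul]
    exact mul_le_mul_of_nonneg_left hR.le (inv_nonneg.mpr hℓ.le)
  exact ENNReal.div_mul_cancel (ENNReal.ofReal_pos.mpr hp).ne' ENNReal.ofReal_ne_top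

/-- `W^per(z) · ∑_{m}(χ*χ)((z+Lm)/ℓ) = v^per(z)` for `v` of range `R ≤ ℓ`, `2ℓ < L`.
[cite: Fournais2020, proof of Lemma 3.2] -/
theorem bigWPer_mul_tsum_selfConv {v : ℝ → ℝ≥0∞} {R : ℝ} (hv : ∀ r, R ≤ r → v r = 0)
    (hχ : IsLocalizationFunction χ) {ℓ L : ℝ} (hℓ : 0 < ℓ) (hRℓ : R ≤ ℓ) (hL : 2 * ℓ < L)
    (hpos : ∀ y : Space, ‖y‖ ≤ R / ℓ → 0 < selfConv χ y) (z : Space) :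
    bigWPer v χ ℓ L z * ∑' m : Fin 3 → ℤ, ENNReal.ofReal (selfConv χ (ℓ⁻¹ • (z + latticeVec L m))) =
      periodizedPotential v L z := by
  unfold bigWPer periodizedPotential
  rw [← ENNReal.tsum_mul_right, ← (Equiv.neg _).tsum_eq fun n => v ‖z - latticeVec L n‖]
  refine tsum_congr fun n => ?_
  simp only [Equiv.neg_apply, latticeVec_neg, sub_neg_eq_add, bigW]
  refine div_mul_tsum_selfConv hχ hℓ hRℓ hL hpos (φ := fun w => v ‖w‖) (fun w hw => ?_) z n
  by_contra h
  exact hw (hv _ (not_lt.mp h))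

/-- `W₁^per(z) · ∑_{m}(χ*χ)((z+Lm)/ℓ) = g^per(z) = ∑_m g(z + Lm)`, `g = v(1-ω)`, for `v` of range
`R ≤ ℓ`, `2ℓ < L`. [cite: Fournais2020, proof of Lemma 3.2] -/
theorem bigW₁Per_mul_tsum_selfConv {v : ℝ → ℝ≥0∞} {R : ℝ} (hv : ∀ r, R ≤ r → v r = 0)
    (ω : Space → ℝ) (hχ : IsLocalizationFunction χ) {ℓ L : ℝ} (hℓ : 0 < ℓ) (hRℓ : R ≤ ℓ)
    (hL : 2 * ℓ < L) (hpos : ∀ y : Space, ‖y‖ ≤ R / ℓ → 0 < selfConv χ y) (z : Space) :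
    bigW₁Per v ω χ ℓ L z * ∑' m : Fin 3 → ℤ, ENNReal.ofReal (selfConv χ (ℓ⁻¹ • (z + latticeVec L m))) =
      ∑' n : Fin 3 → ℤ, v ‖z + latticeVec L n‖ * ENNReal.ofReal (1 - ω (z + latticeVec L n)) := by
  unfold bigW₁Per
  rw [← ENNReal.tsum_mul_right]
  refine tsum_congr fun n => ?_
  simp only [bigW₁]
  refine div_mul_tsum_selfConv hχ hℓ hRℓ hL hpos
    (φ := fun w => v ‖w‖ * ENNReal.ofReal (1 - ω w)) (fun w hw => ?_) z n
  by_contra h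
  exact hw (by rw [hv _ (not_lt.mp h), zero_mul])

/-! ### Assembly -/

/-- The pair part of Lemma 3.2 for one pair: `ℓ⁻³ ∫_Ω w_u^per(x, y) du = v^per(x - y)`.
[cite: Fournais2020, Lemma 3.2 (3.10)–(3.11)] -/
theorem lintegral_pairLocPer {v : ℝ → ℝ≥0∞} {R : ℝ} (hv : ∀ r, R ≤ r → v r = 0)
    (hχ : IsLocalizationFunction χ) {ℓ L : ℝ} (hℓ : 0 < ℓ) (hRℓ : R ≤ ℓ) (hL : 2 * ℓ < L)
    (hpos : ∀ y : Space, ‖y‖ ≤ R / ℓ → 0 < selfConv χ y) (x y : Space) :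
    ∫⁻ u in cell L, pairLocPer v χ ℓ L u x y =
      ENNReal.ofReal (ℓ ^ 3) * periodizedPotential v L (x - y) := by
  have hL0 : 0 < L := by linarith
  unfold pairLocPer
  calc ∫⁻ u in cell L, locFunPer χ ℓ L u x * bigWPer v χ ℓ L (x - y) * locFunPer χ ℓ L u y
      = bigWPer v χ ℓ L (x - y) * ∫⁻ u in cell L, locFunPer χ ℓ L u x * locFunPer χ ℓ L u y := by
        rw [← lintegral_const_mul _ (f := fun u => locFunPer χ ℓ L u x * locFunPer χ ℓ L u y)
          ((measurable_locFunPer hχ ℓ L x).mul (measurable_locFunPer hχ ℓ L y))]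
        exact lintegral_congr fun u => by ring
    _ = ENNReal.ofReal (ℓ ^ 3) * periodizedPotential v L (x - y) := by
        rw [lintegral_locFunPer_mul_locFunPer hχ hℓ hL0, ← mul_assoc, mul_comm (bigWPer _ _ _ _ _),
          mul_assoc, bigWPer_mul_tsum_selfConv hv hχ hℓ hRℓ hL hpos]

/-- The one-body part of Lemma 3.2 for one particle:
`ℓ⁻³ ∫_Ω ∫_Ω w_{1,u}^per(x, y) dy du = ∫_{ℝ³} g(x - y) dy`, `g = v(1-ω)` (Tonelli, the
`u`-integral, cancellation, tiling). [cite: Fournais2020, Lemma 3.2 (3.10)–(3.11)] -/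
theorem lintegral_lintegral_pairLoc₁Per {v : ℝ → ℝ≥0∞} {R : ℝ} (hvm : Measurable v)
    (hv : ∀ r, R ≤ r → v r = 0) {ω : Space → ℝ} (hω : Measurable ω)
    (hχ : IsLocalizationFunction χ) {ℓ L : ℝ} (hℓ : 0 < ℓ) (hRℓ : R ≤ ℓ) (hL : 2 * ℓ < L)
    (hpos : ∀ y : Space, ‖y‖ ≤ R / ℓ → 0 < selfConv χ y) (x : Space) :
    ∫⁻ u in cell L, ∫⁻ y in cell L, pairLoc₁Per v ω χ ℓ L u x y =
      ENNReal.ofReal (ℓ ^ 3) * ∫⁻ y, v ‖x - y‖ * ENNReal.ofReal (1 - ω (x - y)) := by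
  have hL0 : 0 < L := by linarith
  -- the function `g = v(1-ω)` translated
  have hgm : ∀ c : Space, Measurable fun y : Space =>
      v ‖x - y + c‖ * ENNReal.ofReal (1 - ω (x - y + c)) := fun c =>
    (hvm.comp (by fun_prop)).mul ((measurable_const.sub (hω.comp (by fun_prop))).ennreal_ofReal)
  -- joint measurability of the integrand (Tonelli)
  have hjm : Measurable (uncurry fun u y : Space => pairLoc₁Per v ω χ ℓ L u x y) := by
    unfold pairLoc₁Per
    refine Measurable.mul (Measurable.mul ?_ ?_) (measurable_locFunPer₂ hχ ℓ L)
    · exact Measurable.comp (f := fun p : Space × Space => (p.1, x))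
        (g := fun p : Space × Space => locFunPer χ ℓ L p.1 p.2)
        (measurable_locFunPer₂ hχ ℓ L) (measurable_fst.prodMk measurable_const)
    · exact (measurable_bigW₁Per hvm hω hχ ℓ L).comp (measurable_const.sub measurable_snd)
  calc ∫⁻ u in cell L, ∫⁻ y in cell L, pairLoc₁Per v ω χ ℓ L u x y
      = ∫⁻ y in cell L, ∫⁻ u in cell L, pairLoc₁Per v ω χ ℓ L u x y :=
        lintegral_lintegral_swap hjm.aemeasurable
    _ = ∫⁻ y in cell L, bigW₁Per v ω χ ℓ L (x - y) * (ENNReal.ofReal (ℓ ^ 3) *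
          ∑' m : Fin 3 → ℤ, ENNReal.ofReal (selfConv χ (ℓ⁻¹ • (x - y + latticeVec L m)))) := by
        refine lintegral_congr fun y => ?_
        unfold pairLoc₁Per
        rw [← lintegral_locFunPer_mul_locFunPer hχ hℓ hL0 x y, ← lintegral_const_mul _
          (f := fun u => locFunPer χ ℓ L u x * locFunPer χ ℓ L u y)
          ((measurable_locFunPer hχ ℓ L x).mul (measurable_locFunPer hχ ℓ L y))]
        exact lintegral_congr fun u => by ring
    _ = ∫⁻ y in cell L, ENNReal.ofReal (ℓ ^ 3) * ∑' n : Fin 3 → ℤ,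
          v ‖x - y + latticeVec L n‖ * ENNReal.ofReal (1 - ω (x - y + latticeVec L n)) := by
        refine lintegral_congr fun y => ?_
        rw [← mul_assoc, mul_comm (bigW₁Per _ _ _ _ _ _), mul_assoc,
          bigW₁Per_mul_tsum_selfConv hv ω hχ hℓ hRℓ hL hpos]
    _ = ENNReal.ofReal (ℓ ^ 3) * ∑' n : Fin 3 → ℤ, ∫⁻ y in cell L,
          v ‖x - (y - latticeVec L n)‖ * ENNReal.ofReal (1 - ω (x - (y - latticeVec L n))) := by
        rw [lintegral_const_mul _ (Measurable.tsum fun n => hgm (latticeVec L n)),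
          lintegral_tsum fun n => (hgm (latticeVec L n)).aemeasurable]
        congr 1
        refine tsum_congr fun n => lintegral_congr fun y => ?_
        rw [show x - y + latticeVec L n = x - (y - latticeVec L n) by abel]
    _ = ENNReal.ofReal (ℓ ^ 3) * ∫⁻ y, v ‖x - y‖ * ENNReal.ofReal (1 - ω (x - y)) := by
        rw [tsum_lintegral_cell_sub_latticeVec hL0 fun y =>
          v ‖x - y‖ * ENNReal.ofReal (1 - ω (x - y))]

/-- **Fournais 2020, Lemma 3.2** holds: the potential-energy sliding identity (3.10)–(3.11), in
the two-part `ℝ≥0∞` form vendored as `Fournais2020_lemma32`. [cite: Fournais2020, Lemma 3.2 (3.10)–(3.11)] -/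
theorem Fournais2020_lemma32_holds : Fournais2020_lemma32 := by
  intro v R hvm hv ω hω χ hχ ℓ L hℓ hRℓ hL hpos N X
  have hL0 : 0 < L := by linarith
  have hℓ3 : (ENNReal.ofReal ℓ ^ 3)⁻¹ * ENNReal.ofReal (ℓ ^ 3) = 1 := by
    rw [← ENNReal.ofReal_pow hℓ.le]
    exact ENNReal.inv_mul_cancel (by simpa using pow_pos hℓ 3) ENNReal.ofReal_ne_top
  -- measurability of `u ↦ w_u^per(xᵢ, xⱼ)`
  have hpm : ∀ x y : Space, Measurable fun u => pairLocPer v χ ℓ L u x y := fun x y =>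
    ((measurable_locFunPer hχ ℓ L x).mul measurable_const).mul (measurable_locFunPer hχ ℓ L y)
  refine ⟨?_, fun ρμ _ => ?_⟩
  · -- the pair part
    unfold periodicInteraction repLocN
    rw [lintegral_finsetSum _ fun i _ => Finset.measurable_sum _ fun j _ => hpm _ _,
      Finset.mul_sum]
    refine Finset.sum_congr rfl fun i _ => ?_
    rw [lintegral_finsetSum _ fun j _ => hpm _ _, Finset.mul_sum]
    refine Finset.sum_congr rfl fun j _ => ?_
    rw [lintegral_pairLocPer hv hχ hℓ hRℓ hL hpos, ← mul_assoc, hℓ3, one_mul]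
  · -- the one-body part
    unfold attrLocN
    have him : ∀ i : Fin N, Measurable fun u : Space =>
        ∫⁻ y in cell L, pairLoc₁Per v ω χ ℓ L u (X i) y := by
      intro i
      refine Measurable.lintegral_prod_right ?_
      unfold pairLoc₁Per
      refine Measurable.mul (Measurable.mul ?_ ?_) (measurable_locFunPer₂ hχ ℓ L)
      · exact Measurable.comp (f := fun p : Space × Space => (p.1, X i))
          (g := fun p : Space × Space => locFunPer χ ℓ L p.1 p.2)
          (measurable_locFunPer₂ hχ ℓ L) (measurable_fst.prodMk measurable_const)
      · exact (measurable_bigW₁Per hvm hω hχ ℓ L).comp (measurable_const.sub measurable_snd)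
    rw [lintegral_const_mul _ (Finset.measurable_sum _ fun i _ => him i),
      lintegral_finsetSum _ fun i _ => him i, Finset.mul_sum, Finset.mul_sum, Finset.mul_sum]
    refine Finset.sum_congr rfl fun i _ => ?_
    rw [lintegral_lintegral_pairLoc₁Per hvm hv hω hχ hℓ hRℓ hL hpos (X i), ← mul_assoc,
      ← mul_assoc, mul_comm _ (ENNReal.ofReal ρμ), mul_assoc (ENNReal.ofReal ρμ), hℓ3, mul_one]

end Literature.MathematicalPhysics.QuantumManyBody.BoseGas

end
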